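import Literature.AnabelianGeometry.EtaleTheta.TemperedFrobenioidOfKummerTwistTower
import Literature.AnabelianGeometry.EtaleTheta.Discharge.Sec3Cor38OfTower
import Literature.AnabelianGeometry.EtaleTheta.Discharge.Sec3Prop34ConstTateTower
import Literature.AnabelianGeometry.EtaleTheta.Discharge.Sec3PhiZeroCountablePrimes
import HarnessLib

/-!
# [EtTh] Prop. 3.4 (ii) (`Prop34Const`) and Cor. 3.8 (i) ∧ (ii) ∧ (iii) AS TYPED, `Λ = ℤ`, NO BINDER, at the tempered Frobenioid over
# the ζ-TWISTED Kummer–Tate tower — a third model of record, the first whose constant fields MOVE under the Galois group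

S. Mochizuki, *The étale theta function …*, Publ. RIMS **45** (2009) [MochizukiEtTh2009], §3 Prop. 3.4 (ii) p.74 («`div₀(c) =
v_L(c)·div(ϖ_L)`»), Cor. 3.8 (i)–(iii) pp.80–81 [cite: MochizukiEtTh2009, Cor 3.8 p.80].

PROOF-ONLY (theorems only; abc-iut cell, layer L2, seat abc-iut-L2-d2 gen 6; L2-lead R677/R689/R722 «ζ-TWISTED KUMMER TOWER»), the exact
analogue at `TateTowerKummerTwist.temperedFrobenioidC` (p481604) of this lineage's v2 model-of-record files `Sec3Cor38iiiTateTowerKummer` /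
`Sec3Cor38OfTower` (gen 5, p466252 / p467146), whose `dm`-GENERIC engines are consumed BY NAME: `cor38_i_ii_ofRankOneObject_ofTower`,
`hull_selfEquivalence_ofRankOneObject_ofTower`, `nonempty_cor38Hyp_ofRankOneObject`, `countable_primes_perfection_Φ_ofRankOneObject`,
abc-iut-L2-d2 (gen 4)'s apex `cor38_iii_ofRlfZWeak_of_isFrobenioid_of_countable_of_prop34Const`, abc-iut-w5-d153's
`countable_primes_perfection_phiZero`, abc-iut-w6-d048/w6-d052's skeleton lemmas `divHom_const` / `constDIV_one_pow` /
`constDIV_neg_mul` / `shearFn_const` / `constDIV_one_ne_one`.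
* §1 this seat's levels under ANY action `actionOf A ρ` (functions `μ × ⟨ϖ⟩ × ⟨U⟩`, the skeleton part moved by SHEARS): the divisor of a
  constant-valued `b ∈ B₀(S)` (`divZero_eq_zpow_of_forall_snd_eq`), the constant family `ϖ` (`unif_mem_bZero_actionOf`), and «a
  constant-valued equivariant function on a transitive set has constant `ϖ`-exponent» (`snd_apply_eq_of_mem_fZero`) — the root-of-unity
  coordinate MAY vary along the orbit (it is moved by the character) but the divisor does not see it.
* §2 **`prop34ConstC : (DivisorMonoids.ofTower towerC).Prop34Const`** — census A1 is a THEOREM at the twisted tower, every connected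
  tempered covering; `countable_primes_perfection_Φ₀_ofTowerC`.
* §3 **`cor38_temperedFrobenioidC (h) : Cor38_i ∧ Cor38_ii ∧ Cor38_iii h`** for EVERY Cor. 3.8 datum between the twisted tower's tempered
  Frobenioids, NO binder beyond `h`; `exists_cor38Hyp_cor38_temperedFrobenioidC` (`Ψ := 𝟭`); `hull_selfEquivalence_temperedFrobenioidC`.
HONEST FRAMING: a class-(b) design model (NOT the tempered Frobenioid of a Tate curve); `D` one object over the one-point covering; nothing
here bears on [IUTchIII] Cor. 3.12; no side taken; typed ≠ proved for anything else.
-/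

noncomputable section

namespace Literature.AnabelianGeometry.EtaleTheta

open CategoryTheory Opposite Function Literature.AlgebraicGeometry.Frobenioids Literature.AnabelianGeometry.SemiGraphs
  Literature.AlgebraicGeometry.Frobenioids.QuasiTemperoid LogDivisorModel LogDivisorModel.GaloisAction LogDivisorModel.TateTower
  LogDivisorTower TemperedFrobenioid

/-! ## §1 The levels `model A` under an action `actionOf A ρ`: divisors of constant-valued functions -/

namespace LogDivisorModel.TateTowerTwist

open TateTowerFrd

variable {A : Type} [CommGroup A] [Finite A] {P : Type} [Group P] (ρ : P →* Twist A) (S : Action (Type 0) P)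

/-- The skeleton part of a function is moved by the SHEAR of the translation component. [cite: MochizukiEtTh2009, Def 3.3 p.73] -/
theorem snd_actFn_actionOf (g : P) (f : Fn A) :
    ((actionOf A ρ).actFn g f).2 = shearFn (Multiplicative.toAdd (ρ g).2) f.2 := rfl

/-- The divisor at `s` of `b ∈ B₀(S)` with `ϖ`-part `ϖ^c` (any root-of-unity factor) is `c·Σ_j [F_j]`. [cite: MochizukiEtTh2009, Def 3.3 p.73] -/
theorem divAt_eq_constDIV_actionOf (b : (actionOf A ρ).bZero S) (s : S.V) (c : ℤ)
    (hc : (b.1 s).2 = Multiplicative.ofAdd ((c, 0) : ℤ × ℤ)) : (actionOf A ρ).divAt S b s = constDIV c := by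
  change divHom (b.1 s).2 = constDIV c
  rw [hc]
  exact divHom_const c

/-- **`div₀` of an element of `B₀(S)` with constant `ϖ`-part `ϖ^c`**: `div₀ b = [d]^c` for any `d ∈ Φ₀(S)` with constant value `Σ_j [F_j]`
(abc-iut-w6-d052's argument; the `μ`-coordinate is invisible to `div`). [cite: MochizukiEtTh2009, Prop 3.4 p.74] -/
theorem divZero_eq_zpow_of_forall_snd_eq (d : (actionOf A ρ).phiZero S) (hd : ∀ s, d.1 s = (constDIV 1 : TateTower.model.DIV))
    (b : (actionOf A ρ).bZero S) (c : ℤ) (hc : ∀ s, (b.1 s).2 = Multiplicative.ofAdd ((c, 0) : ℤ × ℤ)) :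
    (actionOf A ρ).divZero S b = Algebra.GrothendieckGroup.of d ^ c := by
  have hdpow : ∀ (n : ℕ) s, (d ^ n).1 s = (constDIV n : TateTower.model.DIV) := fun n s => by
    rw [SubmonoidClass.coe_pow, Pi.pow_apply, hd]
    exact constDIV_one_pow n
  obtain ⟨n, rfl | rfl⟩ := Int.eq_nat_or_neg c
  · rw [zpow_natCast, ← map_pow, ← div_one (Algebra.GrothendieckGroup.of (d ^ n)), ← map_one Algebra.GrothendieckGroup.of,
      (actionOf A ρ).divZero_eq_div_iff]
    intro s
    rw [divAt_eq_constDIV_actionOf ρ S b s n (hc s), OneMemClass.coe_one, Pi.one_apply, mul_one, hdpow]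
  · rw [zpow_neg, zpow_natCast, ← map_pow, ← one_div, ← map_one Algebra.GrothendieckGroup.of, (actionOf A ρ).divZero_eq_div_iff]
    intro s
    rw [divAt_eq_constDIV_actionOf ρ S b s (-n) (hc s), OneMemClass.coe_one, Pi.one_apply, hdpow]
    exact constDIV_neg_mul n

/-- The constant family `ϖ` (value `unif A` everywhere) lies in `B₀(S)` — fixed by the whole twist group (`actFnHom_unif`).
[cite: MochizukiEtTh2009, Def 3.3 p.73] -/
theorem unif_mem_bZero_actionOf : (fun _ : S.V => unif A) ∈ (actionOf A ρ).bZero S :=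
  ⟨fun _ => trivial, fun g _ => (actFnHom_unif (ρ g)).symm⟩

/-- The reduced special fibre `Σ_j [F_j]` as an element of `Φ₀(S)` (translation-invariant). [cite: MochizukiEtTh2009, Def 3.3 p.73] -/
theorem constDIV_one_mem_phiZero_actionOf : (fun _ : S.V => (constDIV 1 : TateTower.model.DIV)) ∈ (actionOf A ρ).phiZero S :=
  ⟨fun _ => constDIV_mem_Divplus 1, fun g _ => (shiftDIV_constDIV (Multiplicative.toAdd (ρ g).2) 1).symm⟩

/-- **On a TRANSITIVE `P`-set, a constant-valued equivariant function has CONSTANT `ϖ`-exponent** (its root-of-unity coordinate may move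
along the orbit — it is twisted by the character — but the skeleton part is sheared with `U`-exponent `0`, hence fixed).
[cite: MochizukiEtTh2009, Def 3.3 p.73] -/
theorem snd_apply_eq_of_mem_fZero (htrans : ∀ s u : S.V, ∃ g : P, S.ρ g s = u) (s₀ : S.V) (b : (actionOf A ρ).bZero S)
    (hb : b ∈ (actionOf A ρ).fZero S) (s : S.V) :
    (b.1 s).2 = Multiplicative.ofAdd (((Multiplicative.toAdd (b.1 s₀).2).1, 0) : ℤ × ℤ) := by
  have h0 : (b.1 s₀).2 = Multiplicative.ofAdd (((Multiplicative.toAdd (b.1 s₀).2).1, 0) : ℤ × ℤ) :=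
    Multiplicative.toAdd.injective (Prod.ext rfl ((mem_const_iff A _).1 (hb s₀)))
  obtain ⟨g, rfl⟩ := htrans s₀ s
  rw [b.2.2 g s₀, snd_actFn_actionOf]
  conv_lhs => rw [h0]
  rw [shearFn_const]

end LogDivisorModel.TateTowerTwist

/-! ## §2 `Prop34Const` and countable primes at the ζ-twisted tower -/

namespace TateTowerKummerTwist

open LogDivisorModel.TateTowerTwist TateTowerFrd

/-- **Clause (b) of `Prop34Const` at every connected tempered covering of the ζ-twisted tower** (level `l`): `d := Σ_j [F_j] ∈ Φ₀(Y)` is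
non-cuspidal, `≠ 0`, equals `div₀(ϖ_l)`, and `div₀(b) = c • d` for every `b ∈ F₀(Y)`. [cite: MochizukiEtTh2009, Prop 3.4 p.74] -/
theorem exists_specialFibre_phiZeroC (l : ℕ) (Y : ConnectedPart (BTemp Compat)) :
    ∃ d ∈ (actC l).ncspZero (gset Y), d ≠ 1 ∧
      (∃ ϖ ∈ (actC l).fZero (gset Y), (actC l).divZeroHom (gset Y) ϖ = Algebra.GrothendieckGroup.of d) ∧
      ∀ b ∈ (actC l).fZero (gset Y), ∃ n : ℤ, (actC l).divZeroHom (gset Y) b = Algebra.GrothendieckGroup.of d ^ n := by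
  obtain ⟨⟨s₀⟩, htrans⟩ := (BTemp.isConnectedObj_iff Y.obj).mp Y.property
  let d : (actC l).phiZero (gset Y) := ⟨_, constDIV_one_mem_phiZero_actionOf ((rho l).comp compat.subtype) (gset Y)⟩
  have hd : ∀ s, d.1 s = (constDIV 1 : TateTower.model.DIV) := fun _ => rfl
  refine ⟨d, fun _ => trivial, fun h => constDIV_one_ne_one ((hd s₀).symm.trans (by rw [h]; rfl)), ?_, ?_⟩
  · refine ⟨⟨_, unif_mem_bZero_actionOf ((rho l).comp compat.subtype) (gset Y)⟩, fun _ => unif_mem_const (MuN l), ?_⟩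
    have h := divZero_eq_zpow_of_forall_snd_eq ((rho l).comp compat.subtype) (gset Y) d hd
      ⟨_, unif_mem_bZero_actionOf ((rho l).comp compat.subtype) (gset Y)⟩ 1 (fun _ => rfl)
    rw [zpow_one] at h
    exact h
  · intro b hb
    exact ⟨(Multiplicative.toAdd (b.1 s₀).2).1, divZero_eq_zpow_of_forall_snd_eq ((rho l).comp compat.subtype) (gset Y) d hd b _
      (snd_apply_eq_of_mem_fZero ((rho l).comp compat.subtype) (gset Y) htrans s₀ b hb)⟩

/-- **[EtTh] Prop. 3.4 (ii), abc-iut-L2-t3's bundle `Prop34Const` (census A1), HOLDS at the ζ-TWISTED Kummer–Tate tower datum**, at every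
connected tempered covering. [cite: MochizukiEtTh2009, Prop 3.4 p.74] -/
theorem prop34ConstC : (DivisorMonoids.ofTower towerC).Prop34Const where
  inv_mem_F₀ Y b hb := exists_inv_mem_fZero (actC (lvlC Y.unop)) (gset Y.unop) b hb
  exists_specialFibre Y := exists_specialFibre_phiZeroC (lvlC Y.unop) Y.unop

/-- **`Prime(Φ₀(Y)^pf)` is countable at every connected tempered covering of the ζ-twisted tower** (countable orbit, no cusps,
components `ℤ`; abc-iut-w5-d153's `countable_primes_perfection_phiZero`). [cite: MochizukiEtTh2009, Rmk 3.3.1 p.73] -/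
theorem countable_primes_perfection_Φ₀_ofTowerC (Y : (ConnectedPart (BTemp Compat))ᵒᵖ) :
    Countable (Primes (Perfection ↥((DivisorMonoids.ofTower towerC).Φ₀.obj Y))) := by
  haveI : Countable (gset Y.unop).V := Y.unop.obj.property.1
  haveI : Countable (model (MuN (lvlC Y.unop))).Cusp := show Countable PEmpty.{1} from inferInstance
  haveI : Countable (model (MuN (lvlC Y.unop))).Comp := show Countable ℤ from inferInstance
  exact countable_primes_perfection_phiZero (actC (lvlC Y.unop)) (gset Y.unop)

variable (R S R' S' : ((Discrete PUnit.{1})ᵒᵖ ⥤ CommMonCat.{0}) → Prop)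

/-- `hcnt` at the twisted-tower Frobenioid. [cite: MochizukiEtTh2009, Ex 3.9 p.84] -/
theorem countable_primes_perfection_Φ_temperedFrobenioidC (B : (Discrete PUnit.{1})ᵒᵖ) :
    Countable (Primes (Perfection ↥((temperedFrobenioidC R S).Φ.carrier B))) := by
  haveI := countable_primes_perfection_Φ₀_ofTowerC (op rankOneObjectC.Y₀)
  exact TemperedFrobenioid.countable_primes_perfection_Φ_ofRankOneObject rankOneObjectC hpfC R S B

/-! ## §3 Cor. 3.8 (i) ∧ (ii) ∧ (iii) at the ζ-twisted tower, NO binder -/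

/-- **[EtTh] Cor. 3.8 (iii), first clause (`Λ = ℤ`), at the twisted-tower Frobenioid with NO binder**: for EVERY Cor. 3.8 datum `h`,
`Cor38_iii h` — `hcnt`, `Prop34Const` and «`C` is a Frobenioid» all THEOREMS here. [cite: MochizukiEtTh2009, Cor 3.8 p.81] -/
theorem cor38_iii_temperedFrobenioidC (h : Cor38Hyp (temperedFrobenioidC R S) (temperedFrobenioidC R' S')) : Cor38_iii h :=
  cor38_iii_ofRlfZWeak_of_isFrobenioid_of_countable_of_prop34Const h
    (countable_primes_perfection_Φ_temperedFrobenioidC R S) (countable_primes_perfection_Φ_temperedFrobenioidC R' S')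
    prop34ConstC prop34ConstC (isFrobenioid_temperedFrobenioidC R S) (isFrobenioid_temperedFrobenioidC R' S')

/-- **[EtTh] Cor. 3.8 (i) ∧ (ii) AS TYPED, monoid type `ℤ`, at the twisted-tower Frobenioid, NO binder beyond `h`** (this lineage's
`dm`-generic `cor38_i_ii_ofRankOneObject_ofTower` with `Prop34Const := prop34ConstC`). [cite: MochizukiEtTh2009, Cor 3.8 p.80] -/
theorem cor38_i_ii_temperedFrobenioidC (h : Cor38Hyp (temperedFrobenioidC R S) (temperedFrobenioidC R' S')) :
    Literature.AnabelianGeometry.EtaleTheta.Cor38_i (fun E _ => Literature.AlgebraicGeometry.Frobenioids.IsFrobeniusSlim E) h ∧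
      Literature.AnabelianGeometry.EtaleTheta.Cor38_ii
        (fun E _ Φ => ∀ (B : E) (α : Aut (Over.forget B)),
          (∀ (B' : Over B) (x : Φ.obj (op B'.left)),
            Literature.AlgebraicGeometry.Frobenioids.pull Φ (α.hom.app B') x = x) → α = 1) h :=
  TemperedFrobenioid.cor38_i_ii_ofRankOneObject_ofTower rankOneObjectC hpfC R S rankOneObjectC hpfC R' S' h prop34ConstC
    prop34ConstC

/-- **[EtTh] Cor. 3.8 (i) ∧ (ii) ∧ (iii) AS TYPED, monoid type `ℤ`, at the tempered Frobenioid over the ζ-TWISTED Kummer–Tate tower, for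
every `h`, NO binder beyond `h`.** [cite: MochizukiEtTh2009, Cor 3.8 p.80] -/
theorem cor38_temperedFrobenioidC (h : Cor38Hyp (temperedFrobenioidC R S) (temperedFrobenioidC R' S')) :
    Literature.AnabelianGeometry.EtaleTheta.Cor38_i (fun E _ => Literature.AlgebraicGeometry.Frobenioids.IsFrobeniusSlim E) h ∧
      Literature.AnabelianGeometry.EtaleTheta.Cor38_ii
        (fun E _ Φ => ∀ (B : E) (α : Aut (Over.forget B)),
          (∀ (B' : Over B) (x : Φ.obj (op B'.left)),
            Literature.AlgebraicGeometry.Frobenioids.pull Φ (α.hom.app B') x = x) → α = 1) h ∧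
      Cor38_iii h :=
  ⟨(cor38_i_ii_temperedFrobenioidC R S R' S' h).1, (cor38_i_ii_temperedFrobenioidC R S R' S' h).2,
    cor38_iii_temperedFrobenioidC R S R' S' h⟩

/-- **The CONCLUSIONS of Cor. 3.8 (i), (ii) and the first clause of (iii) at the twisted-tower Frobenioid, for every `h`** (the
one-object base is slim and Div-slim). [cite: MochizukiEtTh2009, Cor 3.8 p.81] -/
theorem cor38_conclusion_temperedFrobenioidC (h : Cor38Hyp (temperedFrobenioidC R S) (temperedFrobenioidC R' S')) :
    (PreservesBaseFieldTheoretic h ∧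
      ∃ Ψbs : (temperedFrobenioidC R S).hullCategory ≌ (temperedFrobenioidC R' S').hullCategory,
        Nonempty ((temperedFrobenioidC R S).hull ⋙ h.Ψ.functor ≅ Ψbs.functor ⋙ (temperedFrobenioidC R' S').hull)) ∧
      Cor38_iii h :=
  ⟨(cor38_i_ii_temperedFrobenioidC R S R' S' h).2 (Toy.isDivSlim45iv_discretePUnit _) (Toy.isDivSlim45iv_discretePUnit _),
    cor38_iii_temperedFrobenioidC R S R' S' h⟩

/-- **The typed statements of the nodes `EtTh:Cor3.8(i)`, `(ii)`, `(iii)` have a SIMULTANEOUS unconditional kernel instance at the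
ζ-TWISTED tower** (`Ψ := 𝟭`) — a model whose constant fields carry recorded roots of unity MOVED by the Galois group.
[cite: MochizukiEtTh2009, Cor 3.8 p.80] -/
theorem exists_cor38Hyp_cor38_temperedFrobenioidC :
    ∃ h : Cor38Hyp (temperedFrobenioidC R S) (temperedFrobenioidC R S),
      Literature.AnabelianGeometry.EtaleTheta.Cor38_i (fun E _ => Literature.AlgebraicGeometry.Frobenioids.IsFrobeniusSlim E) h ∧
        Literature.AnabelianGeometry.EtaleTheta.Cor38_ii
          (fun E _ Φ => ∀ (B : E) (α : Aut (Over.forget B)),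
            (∀ (B' : Over B) (x : Φ.obj (op B'.left)),
              Literature.AlgebraicGeometry.Frobenioids.pull Φ (α.hom.app B') x = x) → α = 1) h ∧
        Cor38_iii h := by
  obtain ⟨h⟩ := TemperedFrobenioid.nonempty_cor38Hyp_ofRankOneObject rankOneObjectC hpfC R S
  exact ⟨h, cor38_temperedFrobenioidC R S R S h⟩

/-- **[EtTh] Cor. 3.8 (ii) for every self-equivalence of the twisted-tower Frobenioid, NO binder.** [cite: MochizukiEtTh2009, Cor 3.8 p.81] -/
theorem hull_selfEquivalence_temperedFrobenioidC (e : (temperedFrobenioidC R S).category ≌ (temperedFrobenioidC R S).category) :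
    (∀ {X Y : (temperedFrobenioidC R S).category} (f : X ⟶ Y),
        (temperedFrobenioidC R S).IsBaseFieldTheoretic f ↔ (temperedFrobenioidC R S).IsBaseFieldTheoretic (e.functor.map f)) ∧
      ∃ e' : (temperedFrobenioidC R S).hullCategory ≌ (temperedFrobenioidC R S).hullCategory,
        Nonempty ((temperedFrobenioidC R S).hull ⋙ e.functor ≅ e'.functor ⋙ (temperedFrobenioidC R S).hull) :=
  TemperedFrobenioid.hull_selfEquivalence_ofRankOneObject_ofTower rankOneObjectC hpfC R S prop34ConstC e

end TateTowerKummerTwist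

end Literature.AnabelianGeometry.EtaleTheta

end
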